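import Summits.HodgeConjecture.HodgeConjecture.Theorems.EndoscopicMiddleDegreeOrthogonalEnvelopedHeckeGraphAnalytic
import Literature.Geometry.Manifold.CoveringSpaceManifold

/-!
# The branches of a Hecke correspondence are holomorphic on the level cover
# (crux `EndoscopicMiddleDegree.OrthogonalEnveloped`, stmt-HodgeConjecture-14300, `--supports`;
# line `purity-sorted-hecke-envelope`, Stub L2 `stub_coverMapHolomorphic`, seat c6)

Let `D : UnitaryBallQuotientDatum p X` (`X(ℂ) ≅ Γ \ 𝔹`), `A` a Hodge model of `X` with comparison
homeomorphism `φ : A.carrier ≃ₜ X(ℂ)`, `N ⊴ Γ`, and suppose that `pL = φ⁻¹ ∘ π : N \ 𝔹 → A.carrier`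
is a local homeomorphism, so that the level cover `L = N \ 𝔹` carries the LIFTED complex structure
(`Literature.Geometry.Manifold.liftChartedSpace`, Lee 2012 Prop. 4.40). For `g ∈ U(V)(F)` with
`g N g⁻¹ ⊆ Γ`, the translated projection `π_g : N[v] ↦ Γ[g v]` (`D.coverMap g`), read through
`φ⁻¹`, is holomorphic `L → A.carrier` (Shimura 1971, Ch. 7 §7.2–7.3: the projections of a modular
correspondence are holomorphic maps of the quotient Riemann surfaces / varieties).

Proof (`stub_coverMapHolomorphic`). Fix `ℓ₀ = N[v₀] ∈ L`, `x₀ = pL ℓ₀` and the piece `s` of `pL`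
at `ℓ₀` (a local homeomorphism equal to `pL` as a function). Near `ℓ₀`,
`F = φ⁻¹ ∘ π_g = (F ∘ s⁻¹) ∘ pL` and `pL` is holomorphic (`contMDiff_proj_of_chartAt_eq`), so it
suffices that `F ∘ s⁻¹` is holomorphic at `x₀`. Take a continuous slice section `σ` of `unif` on
`U ∋ φ x₀ = unif v₀` (`stub_unifSliceSection`), holomorphic in the model
(`stub_sectionHolomorphicOfInjOn` with `stub_unifHolomorphic`), and `γ₀ ∈ Γ`, `c₀ ≠ 0` with
`γ₀ v₀ = c₀ σ(unif v₀)` (field `unif_eq_unif_iff`). Then `S x = N[γ₀⁻¹ σ(φ x)]` is a continuous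
lift of `x` along `pL` with `S x₀ = ℓ₀`, so `s⁻¹ = S` near `x₀` (`s` is injective on its source),
and `F (s⁻¹ x) = φ⁻¹ (unif ((g γ₀⁻¹) σ(φ x)))` there; this is holomorphic at `x₀` because `σ ∘ φ`
is, `v ↦ (g γ₀⁻¹) v` is `ℂ`-linear and preserves the negative cone (an isometry of `V_{τ₁}`), and
`φ⁻¹ ∘ unif` is holomorphic on the cone.

## References

* [Shimura1973] G. Shimura, *Introduction to the arithmetic theory of automorphic functions*,
  Iwanami Shoten / Princeton UP (1971), Ch. 7 §§7.2–7.3.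
* [BergeronMillsonMoeglin2016Balls] N. Bergeron, J. Millson, C. Moeglin, Acta Math. 216 (2016) =
  arXiv:1306.1515, Part 2 §1.4 and §1.8.
* [LeeSmoothManifolds2013] J. M. Lee, *Introduction to Smooth Manifolds*, 2nd ed. (2012),
  Prop. 4.40.
-/

noncomputable section

-- The crux-workfile namespace `Summit.<P>.<Sub>.Cruxes.…` repeats `HodgeConjecture` (single-conjunct summit).
set_option linter.dupNamespace false

namespace Summit.HodgeConjecture.HodgeConjecture.Cruxes.OrthogonalEnveloped.PuritySortedHeckeEnvelope

open scoped Manifold ContDiff Topology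
open Filter
open Literature.AlgebraicGeometry.Motives (SchemeOver ComplexPoints)
open Literature.AlgebraicGeometry.HodgeTheory
open Literature.AlgebraicGeometry.ShimuraVarieties
open Literature.Geometry.Manifold (liftChartedSpace coveringPiece coe_coveringPiece
  mem_coveringPiece_source isManifold_of_atlas_eq_lift contMDiff_proj_of_chartAt_eq)
open Summit.HodgeConjecture.HodgeConjecture.Cruxes.OrthogonalEnveloped.HeckeGraphChow
  (stub_properlyDiscontinuous isCancelSMul_ball stub_ballLocallyCompactT2 stub_unifHolomorphic
    stub_unifSliceSection stub_sectionHolomorphicOfInjOn mdifferentiable_act)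
open Summit.HodgeConjecture.HodgeConjecture.Cruxes.OrthogonalEnveloped.HeckeGraphChow
  (UnifSliceSection.toBall_mk_smul)

/-- **Stub L2 — the branches of a Hecke correspondence are holomorphic.** For `g ∈ U(V)(F)` with
`g N g⁻¹ ⊆ Γ`, the translated projection `N[v] ↦ Γ[g v]` (`D.coverMap N g`), read in the Hodge model through
`φ⁻¹`, is holomorphic for the lifted complex structure on `N \ 𝔹`: near `ℓ₀` it factors through the local
biholomorphism `pL` as `x ↦ φ⁻¹ (unif (g γ₀⁻¹ σ(φ x)))` for a slice section `σ` of `unif` (`stub_unifSliceSection`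
p110875, translated by some `γ₀ ∈ Γ` so that it passes through the sheet of `ℓ₀`), which is holomorphic by
`stub_sectionHolomorphicOfInjOn` (p110878), linearity of `v ↦ g γ₀⁻¹ v` (an isometry, so cone-preserving,
`act_mem_cone_of_mem_unitaryGroup`) and `stub_unifHolomorphic` (p110764). (Shimura: the projections of a
modular correspondence are holomorphic.) [cite: Shimura1973, Ch. 7 §7.2–7.3]
[cite: BergeronMillsonMoeglin2016Balls, Part 2 §1.4 and §1.8] -/
theorem stub_coverMapHolomorphic :
    ∀ {p : ℕ} {X : SchemeOver ℂ} (D : UnitaryBallQuotientDatum p X) (A : HodgeModel p X)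
      (N : Subgroup ↥D.Γ) [N.Normal]
      (hp : IsLocalHomeomorph (A.isAnalytification.isHomeomorph.homeomorph.symm ∘ D.levelProj N))
      (g : GL (Fin (p + 1)) D.E) (hg : g ∈ unitaryGroup (conjRingHom D.E) D.H)
      (hN : ∀ γ ∈ N, g * (γ : GL (Fin (p + 1)) D.E) * g⁻¹ ∈ D.Γ),
      letI : ChartedSpace A.model (D.LevelCover N) := liftChartedSpace hp
      MDifferentiable 𝓘(ℂ, A.model) 𝓘(ℂ, A.model)
        (A.isAnalytification.isHomeomorph.homeomorph.symm ∘ D.coverMap g hg hN) := by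
  classical
  intro p X D A N _
  -- notation: `φ : A.carrier ≃ₜ X(ℂ)`, the projection `pL` and (below) the branch `F`
  set φ : A.carrier ≃ₜ ComplexPoints X := A.isAnalytification.isHomeomorph.homeomorph
  set pL : D.LevelCover N → A.carrier := φ.symm ∘ D.levelProj N
  intro hp g hg hN
  letI : ChartedSpace A.model (D.LevelCover N) := liftChartedSpace hp
  haveI : IsManifold 𝓘(ℂ, A.model) ω (D.LevelCover N) :=
    isManifold_of_atlas_eq_lift 𝓘(ℂ, A.model) ω hp rfl
  haveI := stub_properlyDiscontinuous D
  haveI := isCancelSMul_ball D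
  obtain ⟨hlc, ht2⟩ := stub_ballLocallyCompactT2 D
  haveI := hlc
  haveI := ht2
  set F : D.LevelCover N → A.carrier := φ.symm ∘ D.coverMap g hg hN
  have hUφ : ∀ {U : Set (ComplexPoints X)}, IsOpen U → IsOpen (φ ⁻¹' U) := fun hU ↦
    hU.preimage φ.continuous
  -- `pL` is holomorphic for the lifted structure (identity in the lifted charts)
  have hpLd : MDifferentiable 𝓘(ℂ, A.model) 𝓘(ℂ, A.model) pL :=
    (contMDiff_proj_of_chartAt_eq (I := 𝓘(ℂ, A.model)) (n := ω) hp fun _ ↦ rfl).mdifferentiable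
      (by simp)
  -- `φ⁻¹ ∘ unif` is holomorphic on the negative cone (Stub B)
  have hunif : MDifferentiableOn 𝓘(ℂ, Fin (p + 1) → ℂ) 𝓘(ℂ, A.model)
      (fun v ↦ φ.symm (D.unif v)) D.cone := stub_unifHolomorphic D A
  intro ℓ
  obtain ⟨b₀, rfl⟩ := Quotient.exists_rep ℓ
  obtain ⟨⟨v₀, hv₀⟩, rfl⟩ := Quotient.exists_rep b₀
  show MDifferentiableAt 𝓘(ℂ, A.model) 𝓘(ℂ, A.model) F (D.toLevel N (D.toBall ⟨v₀, hv₀⟩))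
  set ℓ₀ : D.LevelCover N := D.toLevel N (D.toBall ⟨v₀, hv₀⟩)
  -- the piece `s` of `pL` at `ℓ₀` and the base point `x₀ = pL ℓ₀`
  set s : OpenPartialHomeomorph (D.LevelCover N) A.carrier := coveringPiece hp ℓ₀
  have hsrc : ℓ₀ ∈ s.source := mem_coveringPiece_source hp ℓ₀
  have hscoe : (s : D.LevelCover N → A.carrier) = pL := coe_coveringPiece hp ℓ₀
  set x₀ : A.carrier := pL ℓ₀
  have hx₀t : x₀ ∈ s.target := by
    have h := s.map_source hsrc
    rwa [hscoe] at h
  have hφx₀ : φ x₀ = D.unif v₀ := by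
    show φ (φ.symm (D.levelProj N (D.toLevel N (D.toBall ⟨v₀, hv₀⟩)))) = D.unif v₀
    rw [φ.apply_symm_apply]
    rfl
  -- a continuous slice section of `unif` at `unif v₀` (Stub A1), holomorphic in the model (A2)
  obtain ⟨U, σ, i, V, hUo, hP₀U, hσc, hVo, hVc, hsec, hinj⟩ := stub_unifSliceSection D (D.unif v₀)
  have hσd : MDifferentiableOn 𝓘(ℂ, A.model) 𝓘(ℂ, Fin (p + 1) → ℂ) (σ ∘ φ) (φ ⁻¹' U) :=
    stub_sectionHolomorphicOfInjOn D A hunif U σ i V hUo hσc hVo hVc hsec hinj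
  have hx₀U : φ x₀ ∈ U := by
    rw [hφx₀]
    exact hP₀U
  -- `γ₀ ∈ Γ`, `c₀ ≠ 0` with `γ₀ v₀ = c₀ σ(unif v₀)`, i.e. `γ₀⁻¹ σ(unif v₀) = c₀⁻¹ v₀`
  obtain ⟨hσV₀, -, hσu₀⟩ := hsec _ hP₀U
  obtain ⟨γ₀, hγ₀, c₀, hc₀, hγc₀⟩ := (D.unif_eq_unif_iff v₀ hv₀ _ (hVc hσV₀)).1 hσu₀.symm
  change D.act γ₀ v₀ = c₀ • σ (D.unif v₀) at hγc₀
  have hγ₀' : γ₀⁻¹ ∈ D.Γ := inv_mem hγ₀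
  have hγc₀' : D.act γ₀⁻¹ (σ (D.unif v₀)) = c₀⁻¹ • v₀ := by
    rw [← inv_smul_smul₀ hc₀ (σ (D.unif v₀)), ← hγc₀, D.act_smul, ← D.act_mul, inv_mul_cancel,
      D.act_one]
  have hgγ₀ : g * γ₀⁻¹ ∈ unitaryGroup (conjRingHom D.E) D.H :=
    mul_mem hg (D.isCongruenceSubgroup.1 hγ₀')
  -- the local model `H x = φ⁻¹ (unif ((g γ₀⁻¹) σ(φ x)))` of `F ∘ s⁻¹`, holomorphic at `x₀`
  set H : A.carrier → A.carrier := fun x ↦ φ.symm (D.unif (D.act (g * γ₀⁻¹) (σ (φ x))))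
  have hHd : MDifferentiableAt 𝓘(ℂ, A.model) 𝓘(ℂ, A.model) H x₀ := by
    have h1 : MDifferentiableAt 𝓘(ℂ, A.model) 𝓘(ℂ, Fin (p + 1) → ℂ) (σ ∘ φ) x₀ :=
      hσd.mdifferentiableAt ((hUφ hUo).mem_nhds hx₀U)
    have hmem : D.act (g * γ₀⁻¹) ((σ ∘ φ) x₀) ∈ D.cone :=
      D.act_mem_cone_of_mem_unitaryGroup hgγ₀ (hVc (hsec _ hx₀U).1)
    have h2 : MDifferentiableAt 𝓘(ℂ, Fin (p + 1) → ℂ) 𝓘(ℂ, A.model) (fun v ↦ φ.symm (D.unif v))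
        (D.act (g * γ₀⁻¹) ((σ ∘ φ) x₀)) :=
      hunif.mdifferentiableAt ((isOpen_negCone D.Hℂ).mem_nhds hmem)
    have h3 : MDifferentiableAt 𝓘(ℂ, A.model) 𝓘(ℂ, Fin (p + 1) → ℂ) (D.act (g * γ₀⁻¹) ∘ (σ ∘ φ))
        x₀ :=
      (mdifferentiable_act D (g * γ₀⁻¹) _).comp x₀ h1
    have h4 := h2.comp x₀ h3
    exact h4
  -- the continuous lift `S x = N[γ₀⁻¹ σ(φ x)]` of `x ∈ φ⁻¹ U` along `pL`, through `ℓ₀`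
  set cp : (Fin (p + 1) → ℂ) → D.cone := fun u ↦ if h : u ∈ D.cone then ⟨u, h⟩ else ⟨v₀, hv₀⟩
  have hcp_of : ∀ {u : Fin (p + 1) → ℂ} (hu : u ∈ D.cone), cp u = ⟨u, hu⟩ := fun hu ↦ by
    show dite _ _ _ = _
    exact dif_pos hu
  have hcpc : ContinuousOn cp D.cone := by
    rw [continuousOn_iff_continuous_restrict]
    have hid : D.cone.restrict cp = id := funext fun u ↦ hcp_of u.2
    rw [hid]
    exact continuous_id
  have hmemU : ∀ {x : A.carrier}, φ x ∈ U → D.act γ₀⁻¹ (σ (φ x)) ∈ D.cone := fun hx ↦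
    D.act_mem_cone hγ₀' (hVc (hsec _ hx).1)
  set S : A.carrier → D.LevelCover N := fun x ↦ D.toLevel N (D.toBall (cp (D.act γ₀⁻¹ (σ (φ x)))))
  have hS_of : ∀ {x : A.carrier} (hx : φ x ∈ U),
      S x = D.toLevel N (D.toBall ⟨D.act γ₀⁻¹ (σ (φ x)), hmemU hx⟩) := fun hx ↦ by
    show D.toLevel N (D.toBall (cp (D.act γ₀⁻¹ (σ (φ _))))) = _
    rw [hcp_of (hmemU hx)]
  have hpS : ∀ {x : A.carrier}, φ x ∈ U → pL (S x) = x := fun {x} hx ↦ by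
    rw [hS_of hx]
    show φ.symm (D.unif (D.act γ₀⁻¹ (σ (φ x)))) = x
    rw [D.unif_act hγ₀' (hVc (hsec _ hx).1), (hsec _ hx).2.2, φ.symm_apply_apply]
  have hSx₀ : S x₀ = ℓ₀ := by
    rw [hS_of hx₀U]
    have key : (⟨D.act γ₀⁻¹ (σ (φ x₀)), hmemU hx₀U⟩ : D.cone) =
        ⟨c₀⁻¹ • v₀, smul_mem_negCone (inv_ne_zero hc₀) hv₀⟩ := by
      apply Subtype.ext
      show D.act γ₀⁻¹ (σ (φ x₀)) = c₀⁻¹ • v₀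
      rw [hφx₀, hγc₀']
    rw [key, UnifSliceSection.toBall_mk_smul D (inv_ne_zero hc₀) hv₀
      (smul_mem_negCone (inv_ne_zero hc₀) hv₀)]
  have hSc : ContinuousAt S x₀ := by
    have h1 : ContinuousOn (fun x ↦ D.act γ₀⁻¹ (σ (φ x))) (φ ⁻¹' U) :=
      (D.continuous_act γ₀⁻¹).comp_continuousOn (hσc.comp φ.continuous.continuousOn fun _ hx ↦ hx)
    have h2 : ContinuousOn (fun x ↦ cp (D.act γ₀⁻¹ (σ (φ x)))) (φ ⁻¹' U) :=
      hcpc.comp h1 fun _ hx ↦ hmemU hx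
    have h3 : Continuous fun u : D.cone ↦ D.toLevel N (D.toBall u) :=
      continuous_quotient_mk'.comp continuous_quotient_mk'
    exact (h3.comp_continuousOn h2).continuousAt ((hUφ hUo).mem_nhds hx₀U)
  -- near `x₀`: `s⁻¹ = S`, hence `F ∘ s⁻¹ = H`
  have hev : (F ∘ s.symm) =ᶠ[𝓝 x₀] H := by
    have e1 : S ⁻¹' s.source ∈ 𝓝 x₀ :=
      hSc.preimage_mem_nhds (by rw [hSx₀]; exact s.open_source.mem_nhds hsrc)
    have e2 : φ ⁻¹' U ∈ 𝓝 x₀ := (hUφ hUo).mem_nhds hx₀U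
    have e3 : s.target ∈ 𝓝 x₀ := s.open_target.mem_nhds hx₀t
    filter_upwards [e1, e2, e3] with x h1 h2 h3
    have hsymm : s.symm x = S x :=
      s.injOn (s.map_target h3) h1 (by rw [s.right_inv h3, hscoe, hpS h2])
    show F (s.symm x) = H x
    rw [hsymm, hS_of h2]
    show φ.symm (D.unif (D.act g (D.act γ₀⁻¹ (σ (φ x))))) =
      φ.symm (D.unif (D.act (g * γ₀⁻¹) (σ (φ x))))
    rw [D.act_mul]
  have hFs : MDifferentiableAt 𝓘(ℂ, A.model) 𝓘(ℂ, A.model) (F ∘ s.symm) (pL ℓ₀) :=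
    hHd.congr_of_eventuallyEq hev
  -- near `ℓ₀`: `F = (F ∘ s⁻¹) ∘ pL`
  have hev' : F =ᶠ[𝓝 ℓ₀] (F ∘ s.symm) ∘ pL := by
    filter_upwards [s.open_source.mem_nhds hsrc] with ℓ hℓ
    show F ℓ = F (s.symm (pL ℓ))
    rw [← hscoe, s.left_inv hℓ]
  exact (hFs.comp ℓ₀ (hpLd ℓ₀)).congr_of_eventuallyEq hev'

end Summit.HodgeConjecture.HodgeConjecture.Cruxes.OrthogonalEnveloped.PuritySortedHeckeEnvelope

end
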